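import Literature.RingTheory.MvPolynomial.MacaulayHilbertGrowth
import Mathlib.Order.WellQuasiOrder
import HarnessLib

/-!
# Macaulay growth is eventually attained (Bruns–Herzog Cor. 4.2.14)

For a homogeneous ideal `I ⊆ S = K[X_0, …, X_{N-1}]` over a field, the Hilbert function
`H = H(S/I, -)` satisfies Macaulay's bound `H(d + 1) ≤ H(d)^⟨d⟩` for `d ≥ 1`
(`hilbertFunQuot_succ_le_upper`, file `MacaulayHilbertGrowth.lean`), and **equality holds for
all `d ≫ 0`** [BrunsHerzog1998, Cor. 4.2.14]. We prove this here:

* `eventually_succ_eq_upper` — the numerical core (the content of the printed proof of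
  Cor. 4.2.14 together with Thm. 4.2.10 (c) ⇒ (d) ⇒ (a)): if `h : ℕ → ℕ` satisfies
  `h d ≤ #Mon_d` (monomials in `n + 1 ≥ 1` variables) and `h (d + 1) ≤ (h d)^⟨d⟩` for `d ≥ 1`,
  then `h (d + 1) = (h d)^⟨d⟩` for `d ≫ 0`. Proof as printed: the lex segments
  `L_d ⊆ Mon_d` with `#L_d = #Mon_d - h d` satisfy `∇L_d ⊆ L_{d+1}` (Cor. 4.2.9 and nesting of
  lex segments), so `⋃_d L_d` spans a (lex-segment) monomial ideal; it is finitely generated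
  (Dickson's lemma: its set of minimal exponents is a finite antichain), hence `L_{d+1} = ∇L_d`
  beyond the generating degrees, and Cor. 4.2.9 gives `h (d + 1) = #Mon_{d+1} - #∇L_d = (h d)^⟨d⟩`.
* `upperSetHilbertFun_succ_eq_upper_eventually` — for monomial ideals (upper sets of exponents).
* `hilbertFunQuot_succ_eq_upper_eventually` — **Cor. 4.2.14** for homogeneous ideals of
  `MvPolynomial (Fin N) K`, via the leading-exponent upper set.

## References

* [BrunsHerzog1998] W. Bruns, J. Herzog, *Cohen–Macaulay rings*, rev. ed., Cambridge Studies in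
  Advanced Mathematics 39 (1998), §4.2: Cor. 4.2.9, Thm. 4.2.10, Cor. 4.2.14.
-/

open Finset Literature.RingTheory.GradedAlgebra.Macaulay

namespace Literature.RingTheory.MvPolynomial.Macaulay

variable {n : ℕ}

/-! ## Exponent-vector helpers -/

/-- `a ≤ c`, `a ≠ c` forces `deg a < deg c`. [folklore] -/
private theorem sum_lt_sum_of_le_of_ne {N : ℕ} {a c : Fin N → ℕ} (h : a ≤ c) (hne : a ≠ c) :
    ∑ i, a i < ∑ i, c i := by
  obtain ⟨i, hi⟩ : ∃ i, a i ≠ c i := by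
    by_contra! hcon
    exact hne (funext hcon)
  exact sum_lt_sum (fun j _ => h j) ⟨i, mem_univ _, lt_of_le_of_ne (h i) hi⟩

/-- If `a ≤ c` and `a ≠ c`, some coordinate is strictly smaller. [folklore] -/
private theorem exists_apply_lt_of_le_of_ne {N : ℕ} {a c : Fin N → ℕ} (h : a ≤ c) (hne : a ≠ c) :
    ∃ i, a i < c i := by
  by_contra! hcon
  exact hne (funext fun j => le_antisymm (h j) (hcon j))

/-- If `a ≤ c` and `a i < c i` then `a ≤ c / x_i`. [folklore] -/
private theorem le_sub_e {N : ℕ} {a c : Fin N → ℕ} (h : a ≤ c) {i : Fin N} (hi : a i < c i) :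
    a ≤ c - e i := by
  intro j
  simp only [Pi.sub_apply, e, Pi.single_apply]
  split_ifs with hj
  · subst hj; omega
  · simpa using h j

/-- `deg (c / x_i) + 1 = deg c` when `x_i ∣ c`. [folklore] -/
private theorem sum_sub_e_add_one {N : ℕ} {c : Fin N → ℕ} {i : Fin N} (hi : 0 < c i) :
    ∑ j, (c - e i) j + 1 = ∑ j, c j := by
  conv_rhs => rw [← sub_e_add_e hi, sum_add_e]

/-! ## The numerical core -/

/-- **The numerical content of Cor. 4.2.14.** Let `h : ℕ → ℕ` with `h d ≤ #Mon_d` (monomials of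
degree `d` in `n + 1 ≥ 1` variables) and `h (d + 1) ≤ (h d)^⟨d⟩` for all `d ≥ 1`. Then
`h (d + 1) = (h d)^⟨d⟩` for all `d ≫ 0`. (Printed proof: the lex segments `L_d` with
`#L_d = #Mon_d - h d` satisfy `∇L_d ⊆ L_{d+1}`; the monomial ideal they span is finitely generated,
so `L_{d+1} = ∇L_d` for `d ≫ 0`, and Cor. 4.2.9 computes `#Mon_{d+1} - #∇L_d = (h d)^⟨d⟩`.)
[cite: BrunsHerzog1998, Cor. 4.2.14 (proof) with Thm. 4.2.10 (c)⇒(d)] -/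
theorem eventually_succ_eq_upper (n : ℕ) (h : ℕ → ℕ) (hle : ∀ d, h d ≤ (Mon (n + 1) d).card)
    (hmac : ∀ d, 1 ≤ d → h (d + 1) ≤ upper d (h d)) :
    ∃ r, ∀ d, r ≤ d → h (d + 1) = upper d (h d) := by
  classical
  -- lex segments `L d ⊆ Mon_d` with `#L d = #Mon_d - h d`
  have hex : ∀ d, ∃ L : Finset (Fin (n + 1) → ℕ),
      IsLexSeg L d ∧ L.card = (Mon (n + 1) d).card - h d :=
    fun d => exists_isLexSeg_card_eq d _ (Nat.sub_le _ _)
  choose L hL hcard using hex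
  have hdeg : ∀ {a : Fin (n + 1) → ℕ} {d : ℕ}, a ∈ L d → ∑ i, a i = d :=
    fun ha => mem_Mon.1 ((hL _).1 ha)
  -- Cor. 4.2.9: `#∇(L d) = #Mon_{d+1} - (h d)^⟨d⟩` and `(h d)^⟨d⟩ ≤ #Mon_{d+1}`
  have hsh : ∀ d, 1 ≤ d → (shadow (L d)).card = (Mon (n + 1) (d + 1)).card - upper d (h d) ∧
      upper d (h d) ≤ (Mon (n + 1) (d + 1)).card := by
    intro d hd
    have h1 := card_Mon_succ_sub_card_shadow hd (hL d)
    rw [hcard d, Nat.sub_sub_self (hle d)] at h1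
    have h2 : (shadow (L d)).card ≤ (Mon (n + 1) (d + 1)).card :=
      card_le_card (shadow_subset_Mon (hL d).1)
    omega
  -- (1) `∇(L d) ⊆ L (d + 1)` for `d ≥ 1` (nested lex segments)
  have hsub : ∀ d, 1 ≤ d → shadow (L d) ⊆ L (d + 1) := by
    intro d hd
    refine (isLexSeg_shadow (hL d)).subset_of_card_le (hL (d + 1)) ?_
    rw [(hsh d hd).1, hcard (d + 1)]
    exact Nat.sub_le_sub_left (hmac d hd) _
  -- the monomial ideal `S = ⋃_{d ≥ 1} L d`
  let S : Set (Fin (n + 1) → ℕ) := {a | ∃ d, 1 ≤ d ∧ a ∈ L d}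
  -- (2) `S` is an upper set (closed under multiplication by monomials)
  have hS_up : ∀ a c : Fin (n + 1) → ℕ, a ∈ S → a ≤ c → c ∈ S := by
    suffices ∀ t, ∀ a c : Fin (n + 1) → ℕ, ∑ i, c i = t → a ∈ S → a ≤ c → c ∈ S from
      fun a c => this _ a c rfl
    intro t
    induction t using Nat.strong_induction_on with
    | _ t ih =>
      intro a c hct ha hac
      by_cases hne : a = c
      · exact hne ▸ ha
      · obtain ⟨i, hi⟩ := exists_apply_lt_of_le_of_ne hac hne
        have hci : 0 < c i := lt_of_le_of_lt (Nat.zero_le _) hi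
        have hlt : ∑ j, (c - e i) j < t := by
          have := sum_sub_e_add_one hci
          omega
        obtain ⟨d, hd, hmem⟩ := ih _ hlt a (c - e i) rfl ha (le_sub_e hac hi)
        refine ⟨d + 1, by omega, ?_⟩
        have hc := hsub d hd (add_e_mem_shadow hmem i)
        rwa [sub_e_add_e hci] at hc
  -- (3) the minimal exponents of `S`: an antichain, finite by Dickson's lemma
  let M : Set (Fin (n + 1) → ℕ) := {a | a ∈ S ∧ ∀ b ∈ S, b ≤ a → b = a}
  have hM_anti : IsAntichain (· ≤ ·) M := fun a ha b hb hab hle => hab (hb.2 a ha.1 hle)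
  have hM_fin : M.Finite := WellQuasiOrderedLE.finite_of_isAntichain hM_anti
  -- every exponent of `S` lies above a minimal one
  have hM_below : ∀ b ∈ S, ∃ m ∈ M, m ≤ b := by
    suffices ∀ t, ∀ b : Fin (n + 1) → ℕ, ∑ i, b i = t → b ∈ S → ∃ m ∈ M, m ≤ b from
      fun b hb => this _ b rfl hb
    intro t
    induction t using Nat.strong_induction_on with
    | _ t ih =>
      intro b hbt hb
      by_cases hmin : ∀ b' ∈ S, b' ≤ b → b' = b
      · exact ⟨b, ⟨hb, hmin⟩, le_rfl⟩
      · push Not at hmin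
        obtain ⟨b', hb'S, hb'le, hb'ne⟩ := hmin
        obtain ⟨m, hm, hmb'⟩ :=
          ih _ (hbt ▸ sum_lt_sum_of_le_of_ne hb'le hb'ne) b' rfl hb'S
        exact ⟨m, hm, hmb'.trans hb'le⟩
  -- `r ≥ 1` bounds the degrees of the (finitely many) minimal exponents
  obtain ⟨r, hr1, hr⟩ : ∃ r, 1 ≤ r ∧ ∀ m ∈ M, ∑ i, m i ≤ r := by
    refine ⟨max 1 (hM_fin.toFinset.sup fun m => ∑ i, m i), le_max_left _ _, fun m hm => ?_⟩
    exact (Finset.le_sup (f := fun m : Fin (n + 1) → ℕ => ∑ i, m i)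
      (hM_fin.mem_toFinset.2 hm)).trans (le_max_right _ _)
  refine ⟨r, fun d hrd => ?_⟩
  have hd : 1 ≤ d := hr1.trans hrd
  -- (4) `L (d + 1) ⊆ ∇(L d)` for `d ≥ r`
  have hsup : L (d + 1) ⊆ shadow (L d) := by
    intro b hb
    have hdeg_b : ∑ i, b i = d + 1 := hdeg hb
    obtain ⟨m, hm, hmb⟩ := hM_below b ⟨d + 1, by omega, hb⟩
    have hne : m ≠ b := by
      rintro rfl
      have := hr m hm
      omega
    obtain ⟨i, hi⟩ := exists_apply_lt_of_le_of_ne hmb hne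
    have hbi : 0 < b i := lt_of_le_of_lt (Nat.zero_le _) hi
    obtain ⟨d', hd', hmem⟩ := hS_up m (b - e i) hm.1 (le_sub_e hmb hi)
    obtain rfl : d' = d := by
      have h1 := hdeg hmem
      have h2 := sum_sub_e_add_one hbi
      omega
    rw [← sub_e_add_e hbi]
    exact add_e_mem_shadow hmem i
  -- conclusion: `L (d + 1) = ∇(L d)`, and count with Cor. 4.2.9
  have heq : (L (d + 1)).card = (shadow (L d)).card := by
    rw [Subset.antisymm hsup (hsub d hd)]
  have h1 := hsh d hd
  have h2 := hcard (d + 1)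
  have h3 := hle (d + 1)
  omega

/-! ## Monomial ideals -/

open Literature.RingTheory.HilbertSamuel in
/-- **Cor. 4.2.14 for monomial ideals**: for an upper set `E ⊆ ℕ^N` of exponents,
`F(E)(d + 1) = F(E)(d)^⟨d⟩` for all `d ≫ 0`, where `F(E)(d) = #Mon_d - #E_d`.
[cite: BrunsHerzog1998, Cor. 4.2.14] -/
theorem upperSetHilbertFun_succ_eq_upper_eventually (N : ℕ) (E : UpperSet (Fin N →₀ ℕ)) :
    ∃ r, ∀ d, r ≤ d → upperSetHilbertFun N E (d + 1) = upper d (upperSetHilbertFun N E d) := by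
  classical
  rcases Nat.eq_zero_or_pos N with rfl | hN
  · -- no variables: nothing in positive degree
    refine ⟨1, fun d hd => ?_⟩
    have hd' : d ≠ 0 := by omega
    simp [upperSetHilbertFun, hd', upper_zero]
  · obtain ⟨n, rfl⟩ : ∃ n, N = n + 1 := ⟨N - 1, by omega⟩
    refine eventually_succ_eq_upper n (upperSetHilbertFun (n + 1) E) (fun d => ?_)
      fun d hd => upperSetHilbertFun_succ_le_upper (n + 1) E hd
    rw [upperSetHilbertFun, card_Mon, card_finsuppAntidiag_nat_eq_choose, card_univ,
      Fintype.card_fin]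
    exact Nat.sub_le _ _

/-! ## Homogeneous ideals -/

open Literature.RingTheory.HilbertSamuel in
/-- **Bruns–Herzog Cor. 4.2.14.** For a homogeneous ideal `I` of `S = K[X_0, …, X_{N-1}]` over a
field `K`, the Hilbert function of `R = S/I` satisfies `H(R, d + 1) = H(R, d)^⟨d⟩` for all
`d ≫ 0`. [cite: BrunsHerzog1998, Cor. 4.2.14] -/
theorem hilbertFunQuot_succ_eq_upper_eventually {K : Type*} [Field K] {N : ℕ}
    {I : Ideal (_root_.MvPolynomial (Fin N) K)} (hI : IsHomogeneousIdeal I) :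
    ∃ r, ∀ d, r ≤ d → hilbertFunQuot K N I (d + 1) = upper d (hilbertFunQuot K N I d) := by
  rw [hilbertFunQuot_eq_upperSetHilbertFun MonomialOrder.lex hI]
  exact upperSetHilbertFun_succ_eq_upper_eventually N _

end Literature.RingTheory.MvPolynomial.Macaulay
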